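import Summits.AtomisticToContinuum.FouriersLaw.Theses.BondHeatUncertainty
import Summits.AtomisticToContinuum.FouriersLaw.Theorems.ExtensiveSnapshotIrreversibility.Negative.LoadBearingHypotheses
import Summits.AtomisticToContinuum.FouriersLaw.Theorems.ExtensiveSnapshotIrreversibility.Negative.DegenerateInstances
import Summits.AtomisticToContinuum.FouriersLaw.Theorems.BondHeatUncertaintyExtensiveSnapshotIrreversibilityKernelFacts
import Summits.AtomisticToContinuum.FouriersLaw.Theorems.BondHeatUncertaintyExtensiveSnapshotIrreversibilityCorrectorIntegrability
import Summits.AtomisticToContinuum.FouriersLaw.Theorems.BondHeatUncertaintyExtensiveSnapshotIrreversibilityCorrectorCocycle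
import Summits.AtomisticToContinuum.FouriersLaw.Theorems.BondHeatUncertaintyExtensiveSnapshotIrreversibilityGibbsContactCalculus
import Summits.AtomisticToContinuum.FouriersLaw.Theorems.BondHeatUncertaintyExtensiveSnapshotIrreversibilityClausiusBudget
import Summits.AtomisticToContinuum.FouriersLaw.Theorems.BondHeatUncertaintyExtensiveSnapshotIrreversibilityMcLennanIdentification
import Summits.AtomisticToContinuum.FouriersLaw.Theorems.BondHeatUncertaintyExtensiveSnapshotIrreversibilitySnapshotKLUpperReduction
import Summits.AtomisticToContinuum.FouriersLaw.Theorems.BondHeatUncertaintyExtensiveSnapshotIrreversibilityResponseDensity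
import Summits.AtomisticToContinuum.FouriersLaw.Theorems.BondHeatUncertaintyExtensiveSnapshotIrreversibilityLateOddResponseOfFisher
import Summits.AtomisticToContinuum.FouriersLaw.Theorems.BondHeatUncertaintyExtensiveSnapshotIrreversibilityCorrectorHeatSplit
import Summits.AtomisticToContinuum.FouriersLaw.Theorems.BondHeatUncertaintyExtensiveSnapshotIrreversibilityOddCorrectorOfKuboCorrector
import Summits.AtomisticToContinuum.FouriersLaw.Theorems.BondHeatUncertaintyExtensiveSnapshotIrreversibilityCubicOfGreenKuboTime
import Summits.AtomisticToContinuum.FouriersLaw.Theorems.BondHeatUncertaintyExtensiveSnapshotIrreversibilityKlDivFlipLogMeanHellinger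
import Summits.AtomisticToContinuum.FouriersLaw.Theorems.BondHeatUncertaintyExtensiveSnapshotIrreversibilityOddLogDensitySandwichAux3
import Summits.AtomisticToContinuum.FouriersLaw.Theorems.BondHeatUncertaintyExtensiveSnapshotIrreversibilityWeightedOddDQMReduction

/-!
# Line `hellinger-logmean` for crux (K) — ADOPTED by lead c5 as skeleton v3 (2026-08-17T11:45Z): tap-duality v2's provable stubs S_A/S_B are LANDED (p141654/p141379), its N-uniform residual S_C is recorded as a SUFFICIENT condition for S4k (bridge p142181, `stub_kuboCorrectorOddCubicBound_of_greenKuboTime` below), and the fixed-N half is re-routed through S_H0/S_H1/S_H2 instead of the stub-blocked S1r'.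
# (strategist s2 text follows)
# Line `hellinger-logmean` for crux (K) `ExtensiveSnapshotIrreversibility` (stmt-AtomisticToContinuum-9121) — strategist s2, ALT line

(K) ⟸ S_H0 ∧ S_H1 ∧ S_H2 (FIXED `N`: the upper second-order KL expansion through the HELLINGER / logarithmic-mean
route) ∧ S4k (the `N`-UNIFORM cubic odd Kubo-corrector bound, verbatim the stub both registered skeletons consume).

Why this line: the live skeleton (tap-duality v2) and v10 both route the fixed-`N` half through S1r'
`stub_oddLogDensityRegularity` — POINTWISE `δ`-Lipschitz and POINTWISE `δ`-derivative of the odd NESS log-density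
(M2/M2', "not in print", stub-blocked for three lead cycles).  The KL of a density against its momentum flip is HALF A
JEFFREYS DIVERGENCE, `KL(ρ‖ρ∘Θ) = ½∫(ρ − ρ∘Θ)(log ρ − log ρ∘Θ)dx` (Θ is a volume-preserving involution), and the
logarithmic-mean inequality `(a−b)(log a − log b) ≤ (a−b)²/√(ab)` turns it into a HELLINGER quantity:
`KL ≤ ½∫(√ρ − √ρ∘Θ)²(2 + R + R⁻¹)dx`, `R = √(ρ/ρ∘Θ) = e^{d/2}`.  So the fixed-`N` half needs (T1) a two-sided
sandwich of the ODD log-density `|d_δ| ≤ 2η(1+H)` for `δ` small (S1r' clause-4 strength, far weaker than M2) and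
(DQM) quadratic-mean differentiability of `δ ↦ √ρ_δ` (Le Cam) in a mildly weighted `L²(dx)` — an `L²` statement
obtained from a weighted resolvent bound for the `δ`-INDEPENDENT equilibrium generator plus local hypoelliptic
compactness, with NO pointwise `δ`-derivative of the density anywhere.  The `N`-uniform stub is S4k itself (weakest
consumed form; ⟸ sibling E1 stmt-14069 via landed p124332; ⟸ S_C/S_C′ via landed p142181).

Stubs: `stub_klDiv_flip_le_logMeanHellinger` (S_H0: the half-Jeffreys/log-mean bound for ONE positive density,
provable now), `stub_oddLogDensitySandwich` (S_H1 = (T1), fixed `N`), `stub_weightedOddDQM` (S_H2: weighted odd DQM with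
the response-density limit + removable weight + honest integrability, fixed `N`), `stub_kuboCorrectorOddCubicBound`
(S4k, `N`-uniform, hardest).  Composition: `snapshotKLUpperExpansion_of_hellinger` (S_H0 ∧ S_H1 ∧ S_H2 ⇒ the fixed-`N`
child `SnapshotKLUpperExpansion`, filter/real glue) then `crux_of_klExpansion_of_cubic` (= strategist split theorem v2
over the lead's landed v10 composition) ⇒ `ExtensiveSnapshotIrreversibility_of` concludes (K) BY NAME.  Sorries only
in the four stubs.
-/

noncomputable section

namespace Summit.AtomisticToContinuum.FouriersLaw.Cruxes.ExtensiveSnapshotIrreversibility.HellingerLogMean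

open MeasureTheory Filter Topology InformationTheory
open scoped ENNReal NNReal
open Literature.MathematicalPhysics.KineticTheory.HeatConduction
open Summit.AtomisticToContinuum.FouriersLaw.Theses.BondHeatUncertainty
open Summit.AtomisticToContinuum.FouriersLaw.Theorems.ExtensiveSnapshotIrreversibility.Negative
open Summit.AtomisticToContinuum.FouriersLaw.Theorems.ExtensiveSnapshotIrreversibility.ClausiusBudget

/-- Real arithmetic of the window split: `√D ≤ 2√A' + √B'`, `A' ≤ A`, `B' ≤ B` (all nonnegative) give
`D ≤ 8A + 2B`. -/
theorem sq_bound_of_sqrt_le {D A' B' A B : ℝ} (hD : 0 ≤ D) (hA' : 0 ≤ A') (hB' : 0 ≤ B')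
    (hA : A' ≤ A) (hB : B' ≤ B) (h : Real.sqrt D ≤ 2 * Real.sqrt A' + Real.sqrt B') :
    D ≤ 8 * A + 2 * B := by
  have hsA : Real.sqrt A' ≤ Real.sqrt A := Real.sqrt_le_sqrt hA
  have hsB : Real.sqrt B' ≤ Real.sqrt B := Real.sqrt_le_sqrt hB
  have hA0 : 0 ≤ A := hA'.trans hA
  have hB0 : 0 ≤ B := hB'.trans hB
  have h' : Real.sqrt D ≤ 2 * Real.sqrt A + Real.sqrt B := h.trans (by linarith)
  have h1 : Real.sqrt D * Real.sqrt D ≤ (2 * Real.sqrt A + Real.sqrt B) * (2 * Real.sqrt A + Real.sqrt B) :=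
    mul_self_le_mul_self (Real.sqrt_nonneg _) h'
  have hDD : Real.sqrt D * Real.sqrt D = D := Real.mul_self_sqrt hD
  have hAA : Real.sqrt A * Real.sqrt A = A := Real.mul_self_sqrt hA0
  have hBB : Real.sqrt B * Real.sqrt B = B := Real.mul_self_sqrt hB0
  nlinarith [sq_nonneg (2 * Real.sqrt A - Real.sqrt B), Real.sqrt_nonneg A, Real.sqrt_nonneg B]

/-- **Abstract arithmetic core of the composition.** For one parameter point, one family and one `T > 0`: with
`Dw N` the reversal asymmetry of the corrector, `Wk N τ` the squared window norm and `Dl N τ` the late reversal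
asymmetry (any real-valued bookkeeping functions, nonnegative), the four stub-shaped hypotheses give the crux's conclusion
with `C_K = γc/T² + max C 0 + 1`; `N = 0, 1` by the landed Negative lemmas. -/
theorem concl_of_parts {ω₂ lam β γ : ℝ} (hω : 0 < ω₂) (hl : 0 < lam) (hβ : 0 < β) (hγ : 0 < γ)
    (hU : ∀ (N : ℕ) (T_L T_R : ℝ), 0 < T_L → 0 < T_R → ∀ μ ν : Measure (PhaseSpace N),
      (pinnedChain ω₂ lam β γ).IsSteadyState N T_L T_R μ →
      (pinnedChain ω₂ lam β γ).IsSteadyState N T_L T_R ν → μ = ν)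
    {μ : (N : ℕ) → ℝ → ℝ → Measure (PhaseSpace N)}
    (hμ : ∀ (N : ℕ) (T_L T_R : ℝ), 0 < T_L → 0 < T_R →
      (pinnedChain ω₂ lam β γ).IsSteadyState N T_L T_R (μ N T_L T_R))
    {T : ℝ} (hT : 0 < T) {C c : ℝ} (hc : 0 < c)
    (Dw : ℕ → ℝ) (Wk Dl : ℕ → ℝ → ℝ) (hDw : ∀ N, 0 ≤ Dw N) (hWk : ∀ N τ, 0 ≤ Wk N τ) (hDl : ∀ N τ, 0 ≤ Dl N τ)
    (hKL : ∀ N : ℕ, 2 ≤ N → ∀ ε : ℝ, 0 < ε → ∀ᶠ δ in 𝓝[≠] (0 : ℝ),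
      klDiv (μ N (T + δ / 2) (T - δ / 2))
          (Measure.map (fun x : PhaseSpace N => (x.1, -x.2)) (μ N (T + δ / 2) (T - δ / 2)))
        ≤ ENNReal.ofReal ((Dw N / 2 + ε) * δ ^ 2))
    (hSplit : ∀ N : ℕ, 2 ≤ N → ∀ τ : ℝ, 0 ≤ τ →
      Real.sqrt (Dw N) ≤ 2 * Real.sqrt (Wk N τ) + Real.sqrt (Dl N τ))
    (hBudget : ∀ N : ℕ, 2 ≤ N → ∀ τ : ℝ, 0 ≤ τ → Wk N τ ≤ γ * τ / (4 * T ^ 2))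
    (hLate : ∀ N : ℕ, 2 ≤ N → ∃ τ : ℝ, 0 ≤ τ ∧ τ ≤ c * N ∧ Dl N τ ≤ C * N) :
    ∃ C' : ℝ, ∀ N : ℕ, ∀ᶠ δ in 𝓝[≠] (0 : ℝ),
      klDiv (μ N (T + δ / 2) (T - δ / 2))
          (Measure.map (fun x : PhaseSpace N => (x.1, -x.2)) (μ N (T + δ / 2) (T - δ / 2)))
        ≤ ENNReal.ofReal (C' * (N : ℝ) * δ ^ 2) := by
  refine ⟨γ * c / T ^ 2 + max C 0 + 1, fun N => ?_⟩
  rcases Nat.lt_or_ge N 2 with hN | hN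
  · interval_cases N
    · exact extensiveSnapshotIrreversibility_bound_at_zero hμ hT _
    · exact extensiveSnapshotIrreversibility_bound_at_one hω hl hβ hU hμ hT _
  · have hN0 : (0 : ℝ) ≤ N := by positivity
    have hN1 : (1 : ℝ) ≤ N := by exact_mod_cast (le_trans (by norm_num) hN)
    obtain ⟨τ, hτ0, hτc, hL⟩ := hLate N hN
    have hT2 : 0 < T ^ 2 := by positivity
    have hBτ : Wk N τ ≤ γ * (c * N) / (4 * T ^ 2) :=
      (hBudget N hN τ hτ0).trans
        (div_le_div_of_nonneg_right (mul_le_mul_of_nonneg_left hτc hγ.le) (by positivity))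
    have hkey : Dw N ≤ 8 * (γ * (c * N) / (4 * T ^ 2)) + 2 * (max C 0 * N) :=
      sq_bound_of_sqrt_le (hDw N) (hWk N τ) (hDl N τ) hBτ
        (hL.trans (mul_le_mul_of_nonneg_right (le_max_left _ _) hN0))
        (hSplit N hN τ hτ0)
    filter_upwards [hKL N hN 1 one_pos] with δ hδ
    refine hδ.trans (ENNReal.ofReal_le_ofReal ?_)
    have hδ2 : 0 ≤ δ ^ 2 := sq_nonneg δ
    apply mul_le_mul_of_nonneg_right _ hδ2
    have h8 : 8 * (γ * (c * N) / (4 * T ^ 2)) = 2 * (γ * c / T ^ 2 * N) := by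
      field_simp
      ring
    rw [h8] at hkey
    have hgc : 0 ≤ γ * c / T ^ 2 := by positivity
    have hm : 0 ≤ max C 0 := le_max_right _ _
    nlinarith [hkey, hgc, hm, hN1, mul_nonneg hgc hN0, mul_nonneg hm hN0]

/-- **S4 from S4k** (v10: S4 ⟸ S4o at `τ = 0`; S4o ⟸ S4k by the landed `oddCorrectorBound_of_kuboCorrectorOddCubic`). -/
theorem lateOddResponse_of_kuboCorrectorOddCubic
    (hK : ∀ ω₂ lam β γ : ℝ, 0 < ω₂ → 0 < lam → 0 < β → 0 < γ → ∀ T : ℝ, 0 < T → ∃ C : ℝ,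
            ∀ (N : ℕ) (u : PhaseSpace N → ℝ), 2 ≤ N →
              let P := pinnedChain ω₂ lam β γ
              let μT := P.gibbsMeasure N T
              let J : PhaseSpace N → ℝ := fun z => ∑ i : Fin N, P.bondCurrent N i z
              MemLp u 2 μT →
              (∀ᵐ x ∂μT, Tendsto (fun τ : ℝ => ∫ t in Set.Ioc (0 : ℝ) τ,
                  (∫ y, J y ∂(P.transitionKernel N T T t.toNNReal x))) atTop (𝓝 (u x))) →
              ∫ x, (u x - u (x.1, -x.2)) ^ 2 ∂μT ≤ C * (N : ℝ) ^ 3) :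
    ∀ ω₂ lam β γ : ℝ, 0 < ω₂ → 0 < lam → 0 < β → 0 < γ →
      (∀ (N : ℕ) (T_L T_R : ℝ), 0 < T_L → 0 < T_R → ∀ μ ν : Measure (PhaseSpace N),
        (pinnedChain ω₂ lam β γ).IsSteadyState N T_L T_R μ →
        (pinnedChain ω₂ lam β γ).IsSteadyState N T_L T_R ν → μ = ν) →
      ∀ T : ℝ, 0 < T → ∃ C c : ℝ, 0 < c ∧ ∀ (N : ℕ) (hN : 2 ≤ N),
        let P := pinnedChain ω₂ lam β γ
        let μT := P.gibbsMeasure N T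
        (∀ t : ℝ≥0, μT.bind (P.transitionKernel N T T t) = μT) →
        (∀ ϑ : ℝ, 0 < ϑ → ϑ < 1 / T → ∃ C c : ℝ, 0 < C ∧ 0 < c ∧
          ∀ (z : PhaseSpace N) (t : ℝ≥0) (f : PhaseSpace N → ℝ), Continuous f →
            (∀ y, |f y| ≤ Real.exp (ϑ * P.hamiltonian N y)) →
            |(∫ y, f y ∂(P.transitionKernel N T T t z)) - ∫ y, f y ∂μT| ≤
              C * Real.exp (ϑ * P.hamiltonian N z) * Real.exp (-c * t)) →
        let g : PhaseSpace N → ℝ := fun y =>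
          γ / (2 * T ^ 2) * (y.2 ⟨0, by omega⟩ ^ 2 - y.2 ⟨N - 1, by omega⟩ ^ 2)
        let Pg : ℝ → PhaseSpace N → ℝ := fun s z => ∫ y, g y ∂(P.transitionKernel N T T s.toNNReal z)
        let w : PhaseSpace N → ℝ := fun z => ∫ s in Set.Ioi (0 : ℝ), Pg s z
        let Pw : ℝ → PhaseSpace N → ℝ := fun τ z => ∫ x, w x ∂(P.transitionKernel N T T τ.toNNReal z)
        ∃ τ : ℝ, 0 ≤ τ ∧ τ ≤ c * N ∧ MemLp (Pw τ) 2 μT ∧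
          ∫ z, (Pw τ z - Pw τ (z.1, -z.2)) ^ 2 ∂μT ≤ C * N := by
  intro ω₂ lam β γ hω hl hβ hγ hU T hT
  obtain ⟨C', hC'⟩ := oddCorrectorBound_of_kuboCorrectorOddCubic hK ω₂ lam β γ hω hl hβ hγ hU T hT
  refine ⟨max C' 0, 1, one_pos, fun N hN => ?_⟩
  intro P μT hInv hMix g Pg w Pw
  -- `w ∈ L²(μ_T)` from the landed S2a
  obtain ⟨-, hw2, -⟩ := stub_correctorIntegrability ω₂ lam β γ hω hl hβ hγ T hT N hN hInv hMix
  have hON : ∫ z, (w z - w (z.1, -z.2)) ^ 2 ∂μT ≤ C' * N := hC' N hN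
  -- `P_0 w = w`
  have hP0 : ∀ z, Pw 0 z = w z := by
    intro z
    show ∫ x, w x ∂(P.transitionKernel N T T (Real.toNNReal 0) z) = w z
    rw [Real.toNNReal_zero, pinnedChain_transitionKernel_zero hω hl.le hβ.le hγ.le N T T,
      ProbabilityTheory.Kernel.id_apply, integral_dirac]
  have hPw0 : Pw 0 = w := funext hP0
  have hN0 : (0 : ℝ) ≤ N := by positivity
  refine ⟨0, le_rfl, by positivity, ?_, ?_⟩
  · rw [hPw0]; exact hw2
  · rw [hPw0]
    calc ∫ z, (w z - w (z.1, -z.2)) ^ 2 ∂μT ≤ C' * N := hON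
      _ ≤ max C' 0 * N := mul_le_mul_of_nonneg_right (le_max_left C' 0) hN0

/-- **(K) from the fixed-`N` KL upper expansion and the `N`-uniform cubic odd bound** (= strategist split theorem v2,
`SplitV2.lean` on the item; all other pieces landed). -/
theorem crux_of_klExpansion_of_cubic
    (hE : ∀ ω₂ lam β γ : ℝ, 0 < ω₂ → 0 < lam → 0 < β → 0 < γ →
            (∀ (N : ℕ) (T_L T_R : ℝ), 0 < T_L → 0 < T_R → ∀ μ ν : Measure (PhaseSpace N),
              (pinnedChain ω₂ lam β γ).IsSteadyState N T_L T_R μ →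
              (pinnedChain ω₂ lam β γ).IsSteadyState N T_L T_R ν → μ = ν) →
            ∀ μ : (N : ℕ) → ℝ → ℝ → Measure (PhaseSpace N),
              (∀ (N : ℕ) (T_L T_R : ℝ), 0 < T_L → 0 < T_R →
                (pinnedChain ω₂ lam β γ).IsSteadyState N T_L T_R (μ N T_L T_R)) →
              ∀ T : ℝ, 0 < T → ∀ N : ℕ, 2 ≤ N → ∀ h : PhaseSpace N → ℝ,
                (MemLp h 2 (μ N T T) ∧
                  (∀ F : PhaseSpace N → ℝ, ContDiff ℝ ((⊤ : ℕ∞) : WithTop ℕ∞) F → HasCompactSupport F →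
                    Tendsto (fun δ : ℝ => ((∫ x, F x ∂(μ N (T + δ / 2) (T - δ / 2))) - ∫ x, F x ∂(μ N T T)) / δ)
                      (𝓝[≠] (0 : ℝ)) (𝓝 (∫ x, F x * h x ∂(μ N T T)))) ∧
                  (∀ i : Fin N, Tendsto (fun δ : ℝ =>
                      ((∫ x, (pinnedChain ω₂ lam β γ).bondCurrent N i x ∂(μ N (T + δ / 2) (T - δ / 2))) -
                        ∫ x, (pinnedChain ω₂ lam β γ).bondCurrent N i x ∂(μ N T T)) / δ)
                      (𝓝[≠] (0 : ℝ)) (𝓝 (∫ x, (pinnedChain ω₂ lam β γ).bondCurrent N i x * h x ∂(μ N T T))))) →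
                ∀ K : ℝ, (1 / 2 : ℝ) * ∫ x, (h x - h (x.1, -x.2)) ^ 2 ∂(μ N T T) < K →
                  ∀ᶠ δ in 𝓝[≠] (0 : ℝ),
                    klDiv (μ N (T + δ / 2) (T - δ / 2))
                        (Measure.map (fun x : PhaseSpace N => (x.1, -x.2)) (μ N (T + δ / 2) (T - δ / 2)))
                      ≤ ENNReal.ofReal (K * δ ^ 2))
    (hK : ∀ ω₂ lam β γ : ℝ, 0 < ω₂ → 0 < lam → 0 < β → 0 < γ → ∀ T : ℝ, 0 < T → ∃ C : ℝ,
            ∀ (N : ℕ) (u : PhaseSpace N → ℝ), 2 ≤ N →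
              let P := pinnedChain ω₂ lam β γ
              let μT := P.gibbsMeasure N T
              let J : PhaseSpace N → ℝ := fun z => ∑ i : Fin N, P.bondCurrent N i z
              MemLp u 2 μT →
              (∀ᵐ x ∂μT, Tendsto (fun τ : ℝ => ∫ t in Set.Ioc (0 : ℝ) τ,
                  (∫ y, J y ∂(P.transitionKernel N T T t.toNNReal x))) atTop (𝓝 (u x))) →
              ∫ x, (u x - u (x.1, -x.2)) ^ 2 ∂μT ≤ C * (N : ℝ) ^ 3) :
    ExtensiveSnapshotIrreversibility := by
  intro ω₂ lam β γ hω hl hβ hγ hU μ hμ T hT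
  obtain ⟨C, c, hc, hLate⟩ := lateOddResponse_of_kuboCorrectorOddCubic hK ω₂ lam β γ hω hl hβ hγ hU T hT
  -- bookkeeping functions (the line's objects at `N`, as real numbers)
  let g : (N : ℕ) → 2 ≤ N → PhaseSpace N → ℝ := fun N hN y =>
    γ / (2 * T ^ 2) * (y.2 ⟨0, by omega⟩ ^ 2 - y.2 ⟨N - 1, by omega⟩ ^ 2)
  let Pg : (N : ℕ) → 2 ≤ N → ℝ → PhaseSpace N → ℝ := fun N hN s z =>
    ∫ y, g N hN y ∂((pinnedChain ω₂ lam β γ).transitionKernel N T T s.toNNReal z)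
  let k : (N : ℕ) → 2 ≤ N → ℝ → PhaseSpace N → ℝ := fun N hN τ z => ∫ s in (0 : ℝ)..τ, Pg N hN s z
  let w : (N : ℕ) → 2 ≤ N → PhaseSpace N → ℝ := fun N hN z => ∫ s in Set.Ioi (0 : ℝ), Pg N hN s z
  let Pw : (N : ℕ) → 2 ≤ N → ℝ → PhaseSpace N → ℝ := fun N hN τ z =>
    ∫ x, w N hN x ∂((pinnedChain ω₂ lam β γ).transitionKernel N T T τ.toNNReal z)
  let μT : (N : ℕ) → Measure (PhaseSpace N) := fun N => (pinnedChain ω₂ lam β γ).gibbsMeasure N T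
  let Dw : ℕ → ℝ := fun N =>
    if hN : 2 ≤ N then ∫ z, (w N hN z - w N hN (z.1, -z.2)) ^ 2 ∂(μT N) else 0
  let Wk : ℕ → ℝ → ℝ := fun N τ => if hN : 2 ≤ N then ∫ z, (k N hN τ z) ^ 2 ∂(μT N) else 0
  let Dl : ℕ → ℝ → ℝ := fun N τ =>
    if hN : 2 ≤ N then ∫ z, (Pw N hN τ z - Pw N hN τ (z.1, -z.2)) ^ 2 ∂(μT N) else 0
  have hDw : ∀ N, 0 ≤ Dw N := fun N => by
    simp only [Dw]; split_ifs
    · exact integral_nonneg fun _ => sq_nonneg _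
    · exact le_rfl
  have hWk : ∀ N τ, 0 ≤ Wk N τ := fun N τ => by
    simp only [Wk]; split_ifs
    · exact integral_nonneg fun _ => sq_nonneg _
    · exact le_rfl
  have hDl : ∀ N τ, 0 ≤ Dl N τ := fun N τ => by
    simp only [Dl]; split_ifs
    · exact integral_nonneg fun _ => sq_nonneg _
    · exact le_rfl
  -- per-`N` facts from the stubs
  have facts : ∀ N : ℕ, ∀ hN : 2 ≤ N,
      (∀ ε : ℝ, 0 < ε → ∀ᶠ δ in 𝓝[≠] (0 : ℝ),
        klDiv (μ N (T + δ / 2) (T - δ / 2))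
            (Measure.map (fun x : PhaseSpace N => (x.1, -x.2)) (μ N (T + δ / 2) (T - δ / 2)))
          ≤ ENNReal.ofReal ((Dw N / 2 + ε) * δ ^ 2)) ∧
      (∀ τ : ℝ, 0 ≤ τ → Real.sqrt (Dw N) ≤ 2 * Real.sqrt (Wk N τ) + Real.sqrt (Dl N τ)) ∧
      (∀ τ : ℝ, 0 ≤ τ → Wk N τ ≤ γ * τ / (4 * T ^ 2)) ∧
      (∃ τ : ℝ, 0 ≤ τ ∧ τ ≤ c * N ∧ Dl N τ ≤ C * N) := by
    intro N hN
    have hN0 : 0 < N := by omega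
    obtain ⟨hInv, hMix⟩ := stub_equilibriumKernelFacts ω₂ lam β γ hω hl hβ hγ hU T hT N hN0
    obtain ⟨-, hw2, hwin⟩ := stub_correctorIntegrability ω₂ lam β γ hω hl hβ hγ T hT N hN hInv hMix
    have hCalc := stub_gibbsContactCalculus ω₂ lam β γ hω hl hβ hγ T hT N hN0
    have hId := stub_mcLennanIdentification ω₂ lam β γ hω hl hβ hγ hU μ hμ T hT N hN hInv hMix hw2
    obtain ⟨h, hRD⟩ := stub_responseDensity ω₂ lam β γ hω hl hβ hγ hU μ hμ T hT N
    have hKLh := hE ω₂ lam β γ hω hl hβ hγ hU μ hμ T hT N hN h hRD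
    have hKL : ∀ ε : ℝ, 0 < ε → ∀ᶠ δ in 𝓝[≠] (0 : ℝ),
        klDiv (μ N (T + δ / 2) (T - δ / 2))
            (Measure.map (fun x : PhaseSpace N => (x.1, -x.2)) (μ N (T + δ / 2) (T - δ / 2)))
          ≤ ENNReal.ofReal (((∫ z, (w N hN z - w N hN (z.1, -z.2)) ^ 2 ∂(μT N)) / 2 + ε) * δ ^ 2) := by
      intro ε hε
      have hEq : ∫ x, (h x - h (x.1, -x.2)) ^ 2 ∂(μ N T T) =
          ∫ z, (w N hN z - w N hN (z.1, -z.2)) ^ 2 ∂(μT N) := hId h hRD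
      refine hKLh _ ?_
      rw [hEq]
      linarith
    have hBud := stub_clausiusBudget ω₂ lam β γ hω hl hβ hγ hU T hT N hN hInv hMix hCalc
      (fun τ hτ => (hwin τ hτ).1)
    obtain ⟨τ₀, hτ₀, hτ₀c, hPw2, hL⟩ := hLate N hN hInv hMix
    refine ⟨?_, ?_, ?_, ?_⟩
    · intro ε hε
      simpa only [Dw, dif_pos hN] using hKL ε hε
    · intro τ hτ
      obtain ⟨hk2, hPw2', hident⟩ := hwin τ hτ
      have h := stub_correctorCocycle ω₂ lam β γ hω hl hβ hγ T hT N (w N hN) (k N hN τ) (Pw N hN τ)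
        hw2 hk2 hPw2' hident
      simpa only [Dw, Wk, Dl, dif_pos hN] using h
    · intro τ hτ
      simpa only [Wk, dif_pos hN] using hBud τ hτ
    · exact ⟨τ₀, hτ₀, hτ₀c, by simpa only [Dl, dif_pos hN] using hL⟩
  exact concl_of_parts hω hl hβ hγ hU hμ hT hc Dw Wk Dl hDw hWk hDl
    (fun N hN => (facts N hN).1) (fun N hN => (facts N hN).2.1) (fun N hN => (facts N hN).2.2.1)
    (fun N hN => (facts N hN).2.2.2)

-- (composition continues below)

/-! ## The four registered stubs -/

/-- **S_H0 `stub_klDiv_flip_le_logMeanHellinger`** (any `N`, ONE density; elementary, provable now).  For a positive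
measurable probability density `ρ` on phase space whose odd log-ratio is dominated, `|log ρ − log ρ∘Θ| ≤ 2η(1+H)`:
`KL(ρ dx ‖ Θ_*(ρ dx)) ≤ 2∫(√ρ − √ρ∘Θ)² cosh(η(1+H)) dx`
(half-Jeffreys identity for the volume-preserving involution `Θ`, logarithmic-mean inequality
`(a−b)(log a−log b) ≤ (a−b)²/√(ab)`, `½(2 + R + R⁻¹) ≤ 2cosh(d/2)`; the integrability hypothesis keeps the Bochner
integral honest and yields `llr ∈ L¹`). -/
theorem stub_klDiv_flip_le_logMeanHellinger :
    ∀ ω₂ lam β γ : ℝ, ∀ (N : ℕ) (η : ℝ) (ρ : PhaseSpace N → ℝ), Measurable ρ → (∀ x, 0 < ρ x) →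
      (∫⁻ x, ENNReal.ofReal (ρ x) ∂(volume : Measure (PhaseSpace N))) = 1 →
      (∀ x : PhaseSpace N, |Real.log (ρ x) - Real.log (ρ (x.1, -x.2))| ≤
        2 * (η * (1 + (pinnedChain ω₂ lam β γ).hamiltonian N x))) →
      Integrable (fun x : PhaseSpace N => (Real.sqrt (ρ x) - Real.sqrt (ρ (x.1, -x.2))) ^ 2 *
        Real.cosh (η * (1 + (pinnedChain ω₂ lam β γ).hamiltonian N x))) (volume : Measure (PhaseSpace N)) →
      klDiv ((volume : Measure (PhaseSpace N)).withDensity (fun x => ENNReal.ofReal (ρ x)))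
          (Measure.map (fun x : PhaseSpace N => (x.1, -x.2))
            ((volume : Measure (PhaseSpace N)).withDensity (fun x => ENNReal.ofReal (ρ x))))
        ≤ ENNReal.ofReal (2 * ∫ x, (Real.sqrt (ρ x) - Real.sqrt (ρ (x.1, -x.2))) ^ 2 *
            Real.cosh (η * (1 + (pinnedChain ω₂ lam β γ).hamiltonian N x)) ∂(volume : Measure (PhaseSpace N))) :=
  -- LANDED p170482 (S_H0, worker-H0 wave 3, lead c5): `Theorems/BondHeatUncertaintyExtensiveSnapshotIrreversibilityKlDivFlipLogMeanHellinger.lean`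
  _root_.Summit.AtomisticToContinuum.FouriersLaw.Theorems.ExtensiveSnapshotIrreversibility.HellingerLogMean.stub_klDiv_flip_le_logMeanHellinger

/-- **S_H1a `stub_nessLogDensityTwoSided`** (FIXED `N`; the residual isolated by worker-H1's recon, `NessLogDensityTwoSided`:
NOT in print for the direct-Langevin chain — upper half printed for the EPR model only (EPR1999a §3, Eckmann ICM 2002 Rem. 2.2),
lower half unprinted for any heat-conduction chain at fixed temperatures (RBT2000 Thm 1.4 is an ε→0 rate-function sandwich)).
For every continuous positive Lebesgue density family `ρ_δ` of the NESS (`|δ| < 2T`) and every `η' > 0`: a `δ`-UNIFORM two-sided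
Gibbs sandwich `c e^{−(1/T+η')H} ≤ ρ_δ ≤ C e^{−(1/T−η')H}` for `0 < |δ| < δ₁`. -/
theorem stub_nessLogDensityTwoSided :
    ∀ ω₂ lam β γ : ℝ, 0 < ω₂ → 0 < lam → 0 < β → 0 < γ →
      ∀ μ : (N : ℕ) → ℝ → ℝ → Measure (PhaseSpace N),
        (∀ (N : ℕ) (T_L T_R : ℝ), 0 < T_L → 0 < T_R →
          (pinnedChain ω₂ lam β γ).IsSteadyState N T_L T_R (μ N T_L T_R)) →
        ∀ T : ℝ, 0 < T → ∀ N : ℕ, 0 < N →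
          ∀ ρ : ℝ → PhaseSpace N → ℝ, (∀ δ, Continuous (ρ δ)) → (∀ δ x, 0 < ρ δ x) →
            (∀ δ : ℝ, |δ| < 2 * T → μ N (T + δ / 2) (T - δ / 2) =
              (volume : Measure (PhaseSpace N)).withDensity (fun x => ENNReal.ofReal (ρ δ x))) →
            ∀ η' : ℝ, 0 < η' → ∃ δ₁ c C : ℝ, 0 < δ₁ ∧ 0 < c ∧ ∀ δ : ℝ, δ ≠ 0 → |δ| < δ₁ →
              ∀ x : PhaseSpace N,
                c * Real.exp (-((1 / T + η') * (pinnedChain ω₂ lam β γ).hamiltonian N x)) ≤ ρ δ x ∧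
                ρ δ x ≤ C * Real.exp (-((1 / T - η') * (pinnedChain ω₂ lam β γ).hamiltonian N x)) := by
  sorry

/-- **S_H1b `stub_nessDensityEquicontinuous`** (FIXED `N`; `δ`-uniform equicontinuity of the NESS density family on energy sublevel
sets — parameter-uniform hypoelliptic regularity; the tree's Hörmander is qualitative (worker-H1 recon F_equi)). -/
theorem stub_nessDensityEquicontinuous :
    ∀ ω₂ lam β γ : ℝ, 0 < ω₂ → 0 < lam → 0 < β → 0 < γ →
      ∀ μ : (N : ℕ) → ℝ → ℝ → Measure (PhaseSpace N),
        (∀ (N : ℕ) (T_L T_R : ℝ), 0 < T_L → 0 < T_R →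
          (pinnedChain ω₂ lam β γ).IsSteadyState N T_L T_R (μ N T_L T_R)) →
        ∀ T : ℝ, 0 < T → ∀ N : ℕ, 0 < N →
          ∀ ρ : ℝ → PhaseSpace N → ℝ, (∀ δ, Continuous (ρ δ)) → (∀ δ x, 0 < ρ δ x) →
            (∀ δ : ℝ, |δ| < 2 * T → μ N (T + δ / 2) (T - δ / 2) =
              (volume : Measure (PhaseSpace N)).withDensity (fun x => ENNReal.ofReal (ρ δ x))) →
            ∀ R ε : ℝ, 0 < ε → ∃ r : ℝ, 0 < r ∧ ∀ᶠ δ in 𝓝[≠] (0 : ℝ), ∀ x : PhaseSpace N,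
              (pinnedChain ω₂ lam β γ).hamiltonian N x ≤ R →
                ∀ y ∈ Metric.ball x r, |ρ δ y - ρ δ x| ≤ ε := by
  sorry

/-- **S_H1 `stub_oddLogDensitySandwich`** (FIXED `N`; (T1) the one genuinely two-sided input).  For every `η > 0`
and `δ` small the NESS `μ_{N,T+δ/2,T−δ/2}` has a positive measurable probability density `ρ_δ` whose ODD log-ratio is
sandwiched by `2η(1+H)` — implied by a two-sided Gibbs sandwich `c e^{-(1/T+η)H} ≤ ρ_δ ≤ C e^{-(1/T-η)H}`
(upper half printed for EPR reservoirs: Eckmann ICM 2002 Rem. 1.5 / EckmannPilletReyBellet1999a; lower half and the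
direct-Langevin case: `NessLogDensityTwoSided`, not in print — ReyBelletThomas2000 CMP 215 to be checked); exact at the
harmonic corner (`d_δ` = quadratic form with `O(δ)` matrix). -/
theorem stub_oddLogDensitySandwich :
    ∀ ω₂ lam β γ : ℝ, 0 < ω₂ → 0 < lam → 0 < β → 0 < γ →
      ∀ μ : (N : ℕ) → ℝ → ℝ → Measure (PhaseSpace N),
        (∀ (N : ℕ) (T_L T_R : ℝ), 0 < T_L → 0 < T_R →
          (pinnedChain ω₂ lam β γ).IsSteadyState N T_L T_R (μ N T_L T_R)) →
        ∀ T : ℝ, 0 < T → ∀ N : ℕ, 2 ≤ N → ∀ η : ℝ, 0 < η →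
          ∃ δ₀ : ℝ, 0 < δ₀ ∧ ∃ ρ : ℝ → PhaseSpace N → ℝ,
            (∀ δ, Measurable (ρ δ)) ∧ (∀ δ x, 0 < ρ δ x) ∧
            ∀ δ : ℝ, δ ≠ 0 → |δ| < δ₀ →
              μ N (T + δ / 2) (T - δ / 2) =
                (volume : Measure (PhaseSpace N)).withDensity (fun x => ENNReal.ofReal (ρ δ x)) ∧
              (∫⁻ x, ENNReal.ofReal (ρ δ x) ∂(volume : Measure (PhaseSpace N))) = 1 ∧
              ∀ x : PhaseSpace N, |Real.log (ρ δ x) - Real.log (ρ δ (x.1, -x.2))| ≤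
                2 * (η * (1 + (pinnedChain ω₂ lam β γ).hamiltonian N x)) := by
  -- DERIVED (lead c5, skeleton v4): S_H1 ⟸ S_H1a ∧ S_H1b by the landed assembly `helper_oddSandwichOfInputs` (p170624, worker-H1;
  -- canonical smooth density family p170513, local smallness from equicontinuity p170576).
  intro ω₂ lam β γ hω hl hβ hγ μ hμ T hT N hN η hη
  exact Summit.AtomisticToContinuum.FouriersLaw.Theorems.ExtensiveSnapshotIrreversibility.HellingerLogMean.helper_oddSandwichOfInputs ω₂ lam β γ hω hl hβ hγ μ hμ T hT N
    (by omega) (fun ρ hρc hρp hrep => ⟨stub_nessLogDensityTwoSided ω₂ lam β γ hω hl hβ hγ μ hμ T hT N (by omega) ρ hρc hρp hrep,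
      stub_nessDensityEquicontinuous ω₂ lam β γ hω hl hβ hγ μ hμ T hT N (by omega) ρ hρc hρp hrep⟩) η hη


/-- **S_H2a `stub_weightedOddTightness`** (FIXED `N`; (H1) of worker-H2's recon, `WeightedOddTightness`: weighted `L²(dx)`-Lipschitz
response AT ORDER δ of the ODD part of `√ρ_δ` — the analytic heart of the fixed-`N` half; no printed source (nearest: Eckmann–Hairer 2000
weighted resolvent for the EPR model, one δ at a time; Hairer–Majda 2010 weak response = item 9144)). -/
theorem stub_weightedOddTightness :
    ∀ ω₂ lam β γ : ℝ, 0 < ω₂ → 0 < lam → 0 < β → 0 < γ → (∀ (N : ℕ) (T_L T_R : ℝ), 0 < T_L → 0 < T_R → ∀ μ ν :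
      Measure (PhaseSpace N), (pinnedChain ω₂ lam β γ).IsSteadyState N T_L T_R μ → (pinnedChain ω₂ lam β
      γ).IsSteadyState N T_L T_R ν → μ = ν) → ∀ μ : (N : ℕ) → ℝ → ℝ → Measure (PhaseSpace N), (∀ (N : ℕ) (T_L
      T_R : ℝ), 0 < T_L → 0 < T_R → (pinnedChain ω₂ lam β γ).IsSteadyState N T_L T_R (μ N T_L T_R)) → ∀ T : ℝ,
      0 < T → ∀ N : ℕ, 2 ≤ N → ∃ η₀ : ℝ, 0 < η₀ ∧ η₀ ≤ 1 / T ∧ ∀ s : ℝ → PhaseSpace N → ℝ, (∀ δ, Measurable (s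
      δ)) → (∀ δ x, 0 < s δ x) → (∀ᶠ δ in 𝓝[≠] (0 : ℝ), μ N (T + δ / 2) (T - δ / 2) = (volume : Measure
      (PhaseSpace N)).withDensity (fun x => ENNReal.ofReal (s δ x ^ 2))) → ∃ C : ℝ, ∀ᶠ δ in 𝓝[≠] (0 : ℝ),
      Integrable (fun x : PhaseSpace N => (s δ x - s δ (x.1, -x.2)) ^ 2 * Real.exp (η₀ * (pinnedChain ω₂ lam β
      γ).hamiltonian N x)) (volume : Measure (PhaseSpace N)) ∧ ∫ x, (s δ x - s δ (x.1, -x.2)) ^ 2 * Real.exp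
      (η₀ * (pinnedChain ω₂ lam β γ).hamiltonian N x) ∂(volume : Measure (PhaseSpace N)) ≤ C * δ ^ 2 := by
  sorry

/-- **S_H2b `stub_oddDiffQuotLocalL2`** (FIXED `N`; (H2) of worker-H2's recon, `OddDiffQuotLocalL2`: strong `L²_loc` convergence on energy
sublevel sets of the odd difference quotient of `√ρ_δ` to `½(h − h∘Θ)√(ρ_T/Z)` — parameter-uniform local hypoelliptic compactness + the
landed weak response 9144). -/
theorem stub_oddDiffQuotLocalL2 :
    ∀ ω₂ lam β γ : ℝ, 0 < ω₂ → 0 < lam → 0 < β → 0 < γ → (∀ (N : ℕ) (T_L T_R : ℝ), 0 < T_L → 0 < T_R → ∀ μ ν :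
      Measure (PhaseSpace N), (pinnedChain ω₂ lam β γ).IsSteadyState N T_L T_R μ → (pinnedChain ω₂ lam β
      γ).IsSteadyState N T_L T_R ν → μ = ν) → ∀ μ : (N : ℕ) → ℝ → ℝ → Measure (PhaseSpace N), (∀ (N : ℕ) (T_L
      T_R : ℝ), 0 < T_L → 0 < T_R → (pinnedChain ω₂ lam β γ).IsSteadyState N T_L T_R (μ N T_L T_R)) → ∀ T : ℝ,
      0 < T → ∀ N : ℕ, 2 ≤ N → ∀ h : PhaseSpace N → ℝ, (MemLp h 2 (μ N T T) ∧ (∀ F : PhaseSpace N → ℝ, ContDiff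
      ℝ ((⊤ : ℕ∞) : WithTop ℕ∞) F → HasCompactSupport F → Tendsto (fun δ : ℝ => ((∫ x, F x ∂(μ N (T + δ / 2) (T
      - δ / 2))) - ∫ x, F x ∂(μ N T T)) / δ) (𝓝[≠] (0 : ℝ)) (𝓝 (∫ x, F x * h x ∂(μ N T T)))) ∧ (∀ i : Fin N,
      Tendsto (fun δ : ℝ => ((∫ x, (pinnedChain ω₂ lam β γ).bondCurrent N i x ∂(μ N (T + δ / 2) (T - δ / 2))) -
      ∫ x, (pinnedChain ω₂ lam β γ).bondCurrent N i x ∂(μ N T T)) / δ) (𝓝[≠] (0 : ℝ)) (𝓝 (∫ x, (pinnedChain ω₂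
      lam β γ).bondCurrent N i x * h x ∂(μ N T T))))) → ∀ s : ℝ → PhaseSpace N → ℝ, (∀ δ, Measurable (s δ)) →
      (∀ δ x, 0 < s δ x) → (∀ᶠ δ in 𝓝[≠] (0 : ℝ), μ N (T + δ / 2) (T - δ / 2) = (volume : Measure (PhaseSpace
      N)).withDensity (fun x => ENNReal.ofReal (s δ x ^ 2))) → ∀ R : ℝ, (∀ᶠ δ in 𝓝[≠] (0 : ℝ), IntegrableOn
      (fun x : PhaseSpace N => (δ⁻¹ * (s δ x - s δ (x.1, -x.2)) - (1 / 2 : ℝ) * (h x - h (x.1, -x.2)) *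
      Real.sqrt ((pinnedChain ω₂ lam β γ).gibbsDensity N T x / ∫ y, (pinnedChain ω₂ lam β γ).gibbsDensity N T
      y)) ^ 2) {x | (pinnedChain ω₂ lam β γ).hamiltonian N x ≤ R} (volume : Measure (PhaseSpace N))) ∧ Tendsto
      (fun δ : ℝ => ∫ x in {x | (pinnedChain ω₂ lam β γ).hamiltonian N x ≤ R}, (δ⁻¹ * (s δ x - s δ (x.1, -x.2))
      - (1 / 2 : ℝ) * (h x - h (x.1, -x.2)) * Real.sqrt ((pinnedChain ω₂ lam β γ).gibbsDensity N T x / ∫ y,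
      (pinnedChain ω₂ lam β γ).gibbsDensity N T y)) ^ 2 ∂(volume : Measure (PhaseSpace N))) (𝓝[≠] (0 : ℝ)) (𝓝
      0) := by
  sorry

/-- **S_H2 `stub_weightedOddDQM`** (FIXED `N`; Le Cam differentiability in quadratic mean of the odd part, weighted).
For the response density `h` of item 9144 there is `η₀ > 0` such that (i) the weight `cosh(η(1+H))` is removable in
the limit `η → 0` against `(h − h∘Θ)² dμ_{T}` (exponential moments of the odd response density — cf. the landed
mixing bound `|P_s g| ≤ C e^{ϑH} e^{−cs}`), and (ii) for `0 < η < η₀` and ANY positive measurable square-root density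
family `s_δ` of the NESS near `δ = 0`: eventually the weighted odd Hellinger integrand is integrable and
`δ⁻² ∫(s_δ − s_δ∘Θ)² cosh(η(1+H)) dx → ¼ ∫ (h − h∘Θ)² cosh(η(1+H)) dμ_{N,T,T}`
(plan: weighted `L²`-Lipschitz response via the weighted resolvent of the `δ`-independent equilibrium generator with
the free contact Fisher-information bound for tightness; local hypoelliptic compactness + the landed weak response
for the limit on energy sublevel sets). -/
theorem stub_weightedOddDQM :
    ∀ ω₂ lam β γ : ℝ, 0 < ω₂ → 0 < lam → 0 < β → 0 < γ →
      (∀ (N : ℕ) (T_L T_R : ℝ), 0 < T_L → 0 < T_R → ∀ μ ν : Measure (PhaseSpace N),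
        (pinnedChain ω₂ lam β γ).IsSteadyState N T_L T_R μ →
        (pinnedChain ω₂ lam β γ).IsSteadyState N T_L T_R ν → μ = ν) →
      ∀ μ : (N : ℕ) → ℝ → ℝ → Measure (PhaseSpace N),
        (∀ (N : ℕ) (T_L T_R : ℝ), 0 < T_L → 0 < T_R →
          (pinnedChain ω₂ lam β γ).IsSteadyState N T_L T_R (μ N T_L T_R)) →
        ∀ T : ℝ, 0 < T → ∀ N : ℕ, 2 ≤ N → ∀ h : PhaseSpace N → ℝ,
          (MemLp h 2 (μ N T T) ∧
            (∀ F : PhaseSpace N → ℝ, ContDiff ℝ ((⊤ : ℕ∞) : WithTop ℕ∞) F → HasCompactSupport F →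
              Tendsto (fun δ : ℝ => ((∫ x, F x ∂(μ N (T + δ / 2) (T - δ / 2))) - ∫ x, F x ∂(μ N T T)) / δ)
                (𝓝[≠] (0 : ℝ)) (𝓝 (∫ x, F x * h x ∂(μ N T T)))) ∧
            (∀ i : Fin N, Tendsto (fun δ : ℝ =>
                ((∫ x, (pinnedChain ω₂ lam β γ).bondCurrent N i x ∂(μ N (T + δ / 2) (T - δ / 2))) -
                  ∫ x, (pinnedChain ω₂ lam β γ).bondCurrent N i x ∂(μ N T T)) / δ)
                (𝓝[≠] (0 : ℝ)) (𝓝 (∫ x, (pinnedChain ω₂ lam β γ).bondCurrent N i x * h x ∂(μ N T T))))) →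
          ∃ η₀ : ℝ, 0 < η₀ ∧
            (∀ K' : ℝ, ∫ x, (h x - h (x.1, -x.2)) ^ 2 ∂(μ N T T) < K' →
              ∃ η : ℝ, 0 < η ∧ η < η₀ ∧
                ∫ x, (h x - h (x.1, -x.2)) ^ 2 *
                  Real.cosh (η * (1 + (pinnedChain ω₂ lam β γ).hamiltonian N x)) ∂(μ N T T) < K') ∧
            ∀ η : ℝ, 0 < η → η < η₀ →
              ∀ s : ℝ → PhaseSpace N → ℝ, (∀ δ, Measurable (s δ)) → (∀ δ x, 0 < s δ x) →
                (∀ᶠ δ in 𝓝[≠] (0 : ℝ), μ N (T + δ / 2) (T - δ / 2) =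
                  (volume : Measure (PhaseSpace N)).withDensity (fun x => ENNReal.ofReal (s δ x ^ 2))) →
                (∀ᶠ δ in 𝓝[≠] (0 : ℝ), Integrable (fun x : PhaseSpace N => (s δ x - s δ (x.1, -x.2)) ^ 2 *
                    Real.cosh (η * (1 + (pinnedChain ω₂ lam β γ).hamiltonian N x))) (volume : Measure (PhaseSpace N))) ∧
                Tendsto (fun δ : ℝ => (δ ^ 2)⁻¹ * ∫ x, (s δ x - s δ (x.1, -x.2)) ^ 2 *
                    Real.cosh (η * (1 + (pinnedChain ω₂ lam β γ).hamiltonian N x)) ∂(volume : Measure (PhaseSpace N)))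
                  (𝓝[≠] (0 : ℝ))
                  (𝓝 ((1 / 4 : ℝ) * ∫ x, (h x - h (x.1, -x.2)) ^ 2 *
                    Real.cosh (η * (1 + (pinnedChain ω₂ lam β γ).hamiltonian N x)) ∂(μ N T T))) :=
  -- DERIVED (lead c5, skeleton v4): S_H2 ⟸ S_H2a ∧ S_H2b by the landed reduction `stub_weightedOddDQM_of_tight_of_local` (p170867, worker-H2;
  -- clause (i) weight removability p170477, assembly p170695).
  Summit.AtomisticToContinuum.FouriersLaw.Theorems.ExtensiveSnapshotIrreversibility.HellingerLogMean.stub_weightedOddDQM_of_tight_of_local stub_weightedOddTightness stub_oddDiffQuotLocalL2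


/-- **S4k `stub_kuboCorrectorOddCubicBound`** (`N`-UNIFORM, hardest; let-free restatement of the stub registered on
the item and consumed by skeletons v10 / tap-duality): `∫(u − u∘Θ)² dμ_T ≤ C·N³` for every `L²(μ_T)` a.e.-limit `u`
of the finite-horizon Kubo integrals of `J_tot`. -/
theorem stub_kuboCorrectorOddCubicBound :
    ∀ ω₂ lam β γ : ℝ, 0 < ω₂ → 0 < lam → 0 < β → 0 < γ → ∀ T : ℝ, 0 < T → ∃ C : ℝ,
      ∀ (N : ℕ) (u : PhaseSpace N → ℝ), 2 ≤ N →
        MemLp u 2 ((pinnedChain ω₂ lam β γ).gibbsMeasure N T) →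
        (∀ᵐ x ∂((pinnedChain ω₂ lam β γ).gibbsMeasure N T), Tendsto (fun τ : ℝ => ∫ t in Set.Ioc (0 : ℝ) τ,
            (∫ y, (∑ i : Fin N, (pinnedChain ω₂ lam β γ).bondCurrent N i y)
              ∂((pinnedChain ω₂ lam β γ).transitionKernel N T T t.toNNReal x))) atTop (𝓝 (u x))) →
        ∫ x, (u x - u (x.1, -x.2)) ^ 2 ∂((pinnedChain ω₂ lam β γ).gibbsMeasure N T) ≤ C * (N : ℝ) ^ 3 := by
  sorry

/-- **S4k from S_C** (lead c5; landed bridge `TapDuality.kuboCorrectorOddCubic_of_oddCorrectorGreenKuboTime`, p142181,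
itself resting on the landed tap duality S_A p141654 and conductance cap S_B p141379): ANY `N`-uniform Green–Kubo-time bound
`GK(uo) ≤ C·N·∫uo² dμ_T` for the odd Kubo corrector closes the `N`-uniform stub S4k of this skeleton.  (Sorry-free; documents that
the tap-duality line's residual S_C is a sufficient condition here, not a registered stub.) -/
theorem stub_kuboCorrectorOddCubicBound_of_greenKuboTime
    (hC : ∀ ω₂ lam β γ : ℝ, 0 < ω₂ → 0 < lam → 0 < β → 0 < γ → ∀ T : ℝ, 0 < T → ∃ C : ℝ,
      ∀ (N : ℕ) (u : PhaseSpace N → ℝ), 2 ≤ N →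
        MemLp u 2 ((pinnedChain ω₂ lam β γ).gibbsMeasure N T) →
        (∀ᵐ x ∂((pinnedChain ω₂ lam β γ).gibbsMeasure N T),
          Tendsto (fun τ : ℝ => ∫ t in Set.Ioc (0 : ℝ) τ,
            (∫ y, (∑ i : Fin N, (pinnedChain ω₂ lam β γ).bondCurrent N i y)
              ∂((pinnedChain ω₂ lam β γ).transitionKernel N T T t.toNNReal x))) atTop (𝓝 (u x))) →
        ∫ t in Set.Ioi (0 : ℝ), ∫ z, (u z - u (z.1, -z.2)) / 2 *
              (∫ y, (u y - u (y.1, -y.2)) / 2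
                ∂((pinnedChain ω₂ lam β γ).transitionKernel N T T t.toNNReal z))
              ∂((pinnedChain ω₂ lam β γ).gibbsMeasure N T) ≤
          C * N * ∫ z, ((u z - u (z.1, -z.2)) / 2) ^ 2 ∂((pinnedChain ω₂ lam β γ).gibbsMeasure N T)) :
    ∀ ω₂ lam β γ : ℝ, 0 < ω₂ → 0 < lam → 0 < β → 0 < γ → ∀ T : ℝ, 0 < T → ∃ C : ℝ,
      ∀ (N : ℕ) (u : PhaseSpace N → ℝ), 2 ≤ N →
        MemLp u 2 ((pinnedChain ω₂ lam β γ).gibbsMeasure N T) →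
        (∀ᵐ x ∂((pinnedChain ω₂ lam β γ).gibbsMeasure N T), Tendsto (fun τ : ℝ => ∫ t in Set.Ioc (0 : ℝ) τ,
            (∫ y, (∑ i : Fin N, (pinnedChain ω₂ lam β γ).bondCurrent N i y)
              ∂((pinnedChain ω₂ lam β γ).transitionKernel N T T t.toNNReal x))) atTop (𝓝 (u x))) →
        ∫ x, (u x - u (x.1, -x.2)) ^ 2 ∂((pinnedChain ω₂ lam β γ).gibbsMeasure N T) ≤ C * (N : ℝ) ^ 3 :=
  Summit.AtomisticToContinuum.FouriersLaw.Theorems.ExtensiveSnapshotIrreversibility.TapDuality.kuboCorrectorOddCubic_of_oddCorrectorGreenKuboTime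
    hC

/-! ## Composition -/

/-- Real/filter glue: from S_H0, S_H1 and S_H2, the fixed-`N` child `SnapshotKLUpperExpansion` (upper second-order
KL expansion with the sharp coefficient). -/
theorem snapshotKLUpperExpansion_of_hellinger
    (h0 : ∀ ω₂ lam β γ : ℝ, ∀ (N : ℕ) (η : ℝ) (ρ : PhaseSpace N → ℝ), Measurable ρ → (∀ x, 0 < ρ x) →
      (∫⁻ x, ENNReal.ofReal (ρ x) ∂(volume : Measure (PhaseSpace N))) = 1 →
      (∀ x : PhaseSpace N, |Real.log (ρ x) - Real.log (ρ (x.1, -x.2))| ≤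
        2 * (η * (1 + (pinnedChain ω₂ lam β γ).hamiltonian N x))) →
      Integrable (fun x : PhaseSpace N => (Real.sqrt (ρ x) - Real.sqrt (ρ (x.1, -x.2))) ^ 2 *
        Real.cosh (η * (1 + (pinnedChain ω₂ lam β γ).hamiltonian N x))) (volume : Measure (PhaseSpace N)) →
      klDiv ((volume : Measure (PhaseSpace N)).withDensity (fun x => ENNReal.ofReal (ρ x)))
          (Measure.map (fun x : PhaseSpace N => (x.1, -x.2))
            ((volume : Measure (PhaseSpace N)).withDensity (fun x => ENNReal.ofReal (ρ x))))
        ≤ ENNReal.ofReal (2 * ∫ x, (Real.sqrt (ρ x) - Real.sqrt (ρ (x.1, -x.2))) ^ 2 *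
            Real.cosh (η * (1 + (pinnedChain ω₂ lam β γ).hamiltonian N x)) ∂(volume : Measure (PhaseSpace N))))
    (hA : ∀ ω₂ lam β γ : ℝ, 0 < ω₂ → 0 < lam → 0 < β → 0 < γ →
      ∀ μ : (N : ℕ) → ℝ → ℝ → Measure (PhaseSpace N),
        (∀ (N : ℕ) (T_L T_R : ℝ), 0 < T_L → 0 < T_R →
          (pinnedChain ω₂ lam β γ).IsSteadyState N T_L T_R (μ N T_L T_R)) →
        ∀ T : ℝ, 0 < T → ∀ N : ℕ, 2 ≤ N → ∀ η : ℝ, 0 < η →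
          ∃ δ₀ : ℝ, 0 < δ₀ ∧ ∃ ρ : ℝ → PhaseSpace N → ℝ,
            (∀ δ, Measurable (ρ δ)) ∧ (∀ δ x, 0 < ρ δ x) ∧
            ∀ δ : ℝ, δ ≠ 0 → |δ| < δ₀ →
              μ N (T + δ / 2) (T - δ / 2) =
                (volume : Measure (PhaseSpace N)).withDensity (fun x => ENNReal.ofReal (ρ δ x)) ∧
              (∫⁻ x, ENNReal.ofReal (ρ δ x) ∂(volume : Measure (PhaseSpace N))) = 1 ∧
              ∀ x : PhaseSpace N, |Real.log (ρ δ x) - Real.log (ρ δ (x.1, -x.2))| ≤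
                2 * (η * (1 + (pinnedChain ω₂ lam β γ).hamiltonian N x)))
    (hB : ∀ ω₂ lam β γ : ℝ, 0 < ω₂ → 0 < lam → 0 < β → 0 < γ →
      (∀ (N : ℕ) (T_L T_R : ℝ), 0 < T_L → 0 < T_R → ∀ μ ν : Measure (PhaseSpace N),
        (pinnedChain ω₂ lam β γ).IsSteadyState N T_L T_R μ →
        (pinnedChain ω₂ lam β γ).IsSteadyState N T_L T_R ν → μ = ν) →
      ∀ μ : (N : ℕ) → ℝ → ℝ → Measure (PhaseSpace N),
        (∀ (N : ℕ) (T_L T_R : ℝ), 0 < T_L → 0 < T_R →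
          (pinnedChain ω₂ lam β γ).IsSteadyState N T_L T_R (μ N T_L T_R)) →
        ∀ T : ℝ, 0 < T → ∀ N : ℕ, 2 ≤ N → ∀ h : PhaseSpace N → ℝ,
          (MemLp h 2 (μ N T T) ∧
            (∀ F : PhaseSpace N → ℝ, ContDiff ℝ ((⊤ : ℕ∞) : WithTop ℕ∞) F → HasCompactSupport F →
              Tendsto (fun δ : ℝ => ((∫ x, F x ∂(μ N (T + δ / 2) (T - δ / 2))) - ∫ x, F x ∂(μ N T T)) / δ)
                (𝓝[≠] (0 : ℝ)) (𝓝 (∫ x, F x * h x ∂(μ N T T)))) ∧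
            (∀ i : Fin N, Tendsto (fun δ : ℝ =>
                ((∫ x, (pinnedChain ω₂ lam β γ).bondCurrent N i x ∂(μ N (T + δ / 2) (T - δ / 2))) -
                  ∫ x, (pinnedChain ω₂ lam β γ).bondCurrent N i x ∂(μ N T T)) / δ)
                (𝓝[≠] (0 : ℝ)) (𝓝 (∫ x, (pinnedChain ω₂ lam β γ).bondCurrent N i x * h x ∂(μ N T T))))) →
          ∃ η₀ : ℝ, 0 < η₀ ∧
            (∀ K' : ℝ, ∫ x, (h x - h (x.1, -x.2)) ^ 2 ∂(μ N T T) < K' →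
              ∃ η : ℝ, 0 < η ∧ η < η₀ ∧
                ∫ x, (h x - h (x.1, -x.2)) ^ 2 *
                  Real.cosh (η * (1 + (pinnedChain ω₂ lam β γ).hamiltonian N x)) ∂(μ N T T) < K') ∧
            ∀ η : ℝ, 0 < η → η < η₀ →
              ∀ s : ℝ → PhaseSpace N → ℝ, (∀ δ, Measurable (s δ)) → (∀ δ x, 0 < s δ x) →
                (∀ᶠ δ in 𝓝[≠] (0 : ℝ), μ N (T + δ / 2) (T - δ / 2) =
                  (volume : Measure (PhaseSpace N)).withDensity (fun x => ENNReal.ofReal (s δ x ^ 2))) →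
                (∀ᶠ δ in 𝓝[≠] (0 : ℝ), Integrable (fun x : PhaseSpace N => (s δ x - s δ (x.1, -x.2)) ^ 2 *
                    Real.cosh (η * (1 + (pinnedChain ω₂ lam β γ).hamiltonian N x))) (volume : Measure (PhaseSpace N))) ∧
                Tendsto (fun δ : ℝ => (δ ^ 2)⁻¹ * ∫ x, (s δ x - s δ (x.1, -x.2)) ^ 2 *
                    Real.cosh (η * (1 + (pinnedChain ω₂ lam β γ).hamiltonian N x)) ∂(volume : Measure (PhaseSpace N)))
                  (𝓝[≠] (0 : ℝ))
                  (𝓝 ((1 / 4 : ℝ) * ∫ x, (h x - h (x.1, -x.2)) ^ 2 *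
                    Real.cosh (η * (1 + (pinnedChain ω₂ lam β γ).hamiltonian N x)) ∂(μ N T T)))) :
    ∀ ω₂ lam β γ : ℝ, 0 < ω₂ → 0 < lam → 0 < β → 0 < γ →
      (∀ (N : ℕ) (T_L T_R : ℝ), 0 < T_L → 0 < T_R → ∀ μ ν : Measure (PhaseSpace N),
        (pinnedChain ω₂ lam β γ).IsSteadyState N T_L T_R μ →
        (pinnedChain ω₂ lam β γ).IsSteadyState N T_L T_R ν → μ = ν) →
      ∀ μ : (N : ℕ) → ℝ → ℝ → Measure (PhaseSpace N),
        (∀ (N : ℕ) (T_L T_R : ℝ), 0 < T_L → 0 < T_R →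
          (pinnedChain ω₂ lam β γ).IsSteadyState N T_L T_R (μ N T_L T_R)) →
        ∀ T : ℝ, 0 < T → ∀ N : ℕ, 2 ≤ N → ∀ h : PhaseSpace N → ℝ,
          (MemLp h 2 (μ N T T) ∧
            (∀ F : PhaseSpace N → ℝ, ContDiff ℝ ((⊤ : ℕ∞) : WithTop ℕ∞) F → HasCompactSupport F →
              Tendsto (fun δ : ℝ => ((∫ x, F x ∂(μ N (T + δ / 2) (T - δ / 2))) - ∫ x, F x ∂(μ N T T)) / δ)
                (𝓝[≠] (0 : ℝ)) (𝓝 (∫ x, F x * h x ∂(μ N T T)))) ∧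
            (∀ i : Fin N, Tendsto (fun δ : ℝ =>
                ((∫ x, (pinnedChain ω₂ lam β γ).bondCurrent N i x ∂(μ N (T + δ / 2) (T - δ / 2))) -
                  ∫ x, (pinnedChain ω₂ lam β γ).bondCurrent N i x ∂(μ N T T)) / δ)
                (𝓝[≠] (0 : ℝ)) (𝓝 (∫ x, (pinnedChain ω₂ lam β γ).bondCurrent N i x * h x ∂(μ N T T))))) →
          ∀ K : ℝ, (1 / 2 : ℝ) * ∫ x, (h x - h (x.1, -x.2)) ^ 2 ∂(μ N T T) < K →
            ∀ᶠ δ in 𝓝[≠] (0 : ℝ),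
              klDiv (μ N (T + δ / 2) (T - δ / 2))
                  (Measure.map (fun x : PhaseSpace N => (x.1, -x.2)) (μ N (T + δ / 2) (T - δ / 2)))
                ≤ ENNReal.ofReal (K * δ ^ 2) := by
  intro ω₂ lam β γ hω hl hβ hγ hU μ hμ T hT N hN h hRD K hK
  set H : PhaseSpace N → ℝ := fun x => (pinnedChain ω₂ lam β γ).hamiltonian N x with hHdef
  obtain ⟨η₀, hη₀, hWt, hDQM⟩ := hB ω₂ lam β γ hω hl hβ hγ hU μ hμ T hT N hN h hRD
  -- remove the weight: pick `η` with the weighted odd norm still below `2K`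
  have h2K : ∫ x, (h x - h (x.1, -x.2)) ^ 2 ∂(μ N T T) < 2 * K := by linarith
  obtain ⟨η, hη, hηη₀, hηK⟩ := hWt (2 * K) h2K
  -- the odd sandwich at this `η`: a positive density family `ρ δ`
  obtain ⟨δ₀, hδ₀, ρ, hρm, hρpos, hAδ⟩ := hA ω₂ lam β γ hω hl hβ hγ μ hμ T hT N hN η hη
  -- its square root
  set s : ℝ → PhaseSpace N → ℝ := fun δ x => Real.sqrt (ρ δ x) with hsdef
  have hsm : ∀ δ, Measurable (s δ) := fun δ => (hρm δ).sqrt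
  have hspos : ∀ δ x, 0 < s δ x := fun δ x => Real.sqrt_pos.2 (hρpos δ x)
  have hs2 : ∀ δ x, s δ x ^ 2 = ρ δ x := fun δ x => Real.sq_sqrt (hρpos δ x).le
  have hball : ∀ᶠ δ in 𝓝[≠] (0 : ℝ), δ ≠ 0 ∧ |δ| < δ₀ := by
    have h1 : ∀ᶠ δ in 𝓝[≠] (0 : ℝ), δ ≠ 0 := self_mem_nhdsWithin
    have h2 : ∀ᶠ δ in 𝓝[≠] (0 : ℝ), |δ| < δ₀ := by
      have : ∀ᶠ δ in 𝓝 (0 : ℝ), |δ| < δ₀ := by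
        simpa [abs_sub_comm] using eventually_abs_sub_lt (0 : ℝ) hδ₀
      exact this.filter_mono nhdsWithin_le_nhds
    exact h1.and h2
  have hid : ∀ᶠ δ in 𝓝[≠] (0 : ℝ), μ N (T + δ / 2) (T - δ / 2) =
      (volume : Measure (PhaseSpace N)).withDensity (fun x => ENNReal.ofReal (s δ x ^ 2)) := by
    refine hball.mono fun δ hδ => ?_
    have := (hAδ δ hδ.1 hδ.2).1
    simpa only [hs2] using this
  obtain ⟨hInt, hT'⟩ := hDQM η hη hηη₀ s hsm hspos hid
  -- the limit is `< K / 2`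
  have hL : (1 / 4 : ℝ) * ∫ x, (h x - h (x.1, -x.2)) ^ 2 * Real.cosh (η * (1 + H x)) ∂(μ N T T) < K / 2 := by
    have := hηK
    simp only [hHdef] at this ⊢
    linarith
  have hev : ∀ᶠ δ in 𝓝[≠] (0 : ℝ), (δ ^ 2)⁻¹ * ∫ x, (s δ x - s δ (x.1, -x.2)) ^ 2 *
      Real.cosh (η * (1 + H x)) ∂(volume : Measure (PhaseSpace N)) < K / 2 :=
    (tendsto_order.1 hT').2 _ hL
  filter_upwards [hball, hev, hInt] with δ hδ hδK hδI
  obtain ⟨hμρ, hnorm, hsand⟩ := hAδ δ hδ.1 hδ.2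
  -- the log-mean Hellinger bound for `ρ δ`
  have hKL := h0 ω₂ lam β γ N η (ρ δ) (hρm δ) (hρpos δ) hnorm hsand (by simpa only [hsdef] using hδI)
  rw [hμρ]
  refine hKL.trans (ENNReal.ofReal_le_ofReal ?_)
  have hδ2 : 0 < δ ^ 2 := lt_of_le_of_ne (sq_nonneg δ) (Ne.symm (pow_ne_zero 2 hδ.1))
  set I : ℝ := ∫ x, (s δ x - s δ (x.1, -x.2)) ^ 2 * Real.cosh (η * (1 + H x)) ∂(volume : Measure (PhaseSpace N))
    with hI
  have hI' : (δ ^ 2)⁻¹ * I < K / 2 := hδK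
  have hmul : I < K / 2 * δ ^ 2 := by
    have := mul_lt_mul_of_pos_right hI' hδ2
    rwa [mul_comm, ← mul_assoc, mul_inv_cancel₀ hδ2.ne', one_mul] at this
  show 2 * (∫ x, (Real.sqrt (ρ δ x) - Real.sqrt (ρ δ (x.1, -x.2))) ^ 2 *
      Real.cosh (η * (1 + (pinnedChain ω₂ lam β γ).hamiltonian N x)) ∂(volume : Measure (PhaseSpace N))) ≤ K * δ ^ 2
  have hIeq : (∫ x, (Real.sqrt (ρ δ x) - Real.sqrt (ρ δ (x.1, -x.2))) ^ 2 *
      Real.cosh (η * (1 + (pinnedChain ω₂ lam β γ).hamiltonian N x)) ∂(volume : Measure (PhaseSpace N))) = I := by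
    simp only [hI, hsdef, hHdef]
  rw [hIeq]
  linarith

/-- **The line's composition**: (K) `ExtensiveSnapshotIrreversibility` from the four stubs, concluding the crux BY NAME. -/
theorem ExtensiveSnapshotIrreversibility_of_parts
    (h0 : ∀ ω₂ lam β γ : ℝ, ∀ (N : ℕ) (η : ℝ) (ρ : PhaseSpace N → ℝ), Measurable ρ → (∀ x, 0 < ρ x) →
      (∫⁻ x, ENNReal.ofReal (ρ x) ∂(volume : Measure (PhaseSpace N))) = 1 →
      (∀ x : PhaseSpace N, |Real.log (ρ x) - Real.log (ρ (x.1, -x.2))| ≤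
        2 * (η * (1 + (pinnedChain ω₂ lam β γ).hamiltonian N x))) →
      Integrable (fun x : PhaseSpace N => (Real.sqrt (ρ x) - Real.sqrt (ρ (x.1, -x.2))) ^ 2 *
        Real.cosh (η * (1 + (pinnedChain ω₂ lam β γ).hamiltonian N x))) (volume : Measure (PhaseSpace N)) →
      klDiv ((volume : Measure (PhaseSpace N)).withDensity (fun x => ENNReal.ofReal (ρ x)))
          (Measure.map (fun x : PhaseSpace N => (x.1, -x.2))
            ((volume : Measure (PhaseSpace N)).withDensity (fun x => ENNReal.ofReal (ρ x))))
        ≤ ENNReal.ofReal (2 * ∫ x, (Real.sqrt (ρ x) - Real.sqrt (ρ (x.1, -x.2))) ^ 2 *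
            Real.cosh (η * (1 + (pinnedChain ω₂ lam β γ).hamiltonian N x)) ∂(volume : Measure (PhaseSpace N))))
    (hA : ∀ ω₂ lam β γ : ℝ, 0 < ω₂ → 0 < lam → 0 < β → 0 < γ →
      ∀ μ : (N : ℕ) → ℝ → ℝ → Measure (PhaseSpace N),
        (∀ (N : ℕ) (T_L T_R : ℝ), 0 < T_L → 0 < T_R →
          (pinnedChain ω₂ lam β γ).IsSteadyState N T_L T_R (μ N T_L T_R)) →
        ∀ T : ℝ, 0 < T → ∀ N : ℕ, 2 ≤ N → ∀ η : ℝ, 0 < η →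
          ∃ δ₀ : ℝ, 0 < δ₀ ∧ ∃ ρ : ℝ → PhaseSpace N → ℝ,
            (∀ δ, Measurable (ρ δ)) ∧ (∀ δ x, 0 < ρ δ x) ∧
            ∀ δ : ℝ, δ ≠ 0 → |δ| < δ₀ →
              μ N (T + δ / 2) (T - δ / 2) =
                (volume : Measure (PhaseSpace N)).withDensity (fun x => ENNReal.ofReal (ρ δ x)) ∧
              (∫⁻ x, ENNReal.ofReal (ρ δ x) ∂(volume : Measure (PhaseSpace N))) = 1 ∧
              ∀ x : PhaseSpace N, |Real.log (ρ δ x) - Real.log (ρ δ (x.1, -x.2))| ≤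
                2 * (η * (1 + (pinnedChain ω₂ lam β γ).hamiltonian N x)))
    (hB : ∀ ω₂ lam β γ : ℝ, 0 < ω₂ → 0 < lam → 0 < β → 0 < γ →
      (∀ (N : ℕ) (T_L T_R : ℝ), 0 < T_L → 0 < T_R → ∀ μ ν : Measure (PhaseSpace N),
        (pinnedChain ω₂ lam β γ).IsSteadyState N T_L T_R μ →
        (pinnedChain ω₂ lam β γ).IsSteadyState N T_L T_R ν → μ = ν) →
      ∀ μ : (N : ℕ) → ℝ → ℝ → Measure (PhaseSpace N),
        (∀ (N : ℕ) (T_L T_R : ℝ), 0 < T_L → 0 < T_R →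
          (pinnedChain ω₂ lam β γ).IsSteadyState N T_L T_R (μ N T_L T_R)) →
        ∀ T : ℝ, 0 < T → ∀ N : ℕ, 2 ≤ N → ∀ h : PhaseSpace N → ℝ,
          (MemLp h 2 (μ N T T) ∧
            (∀ F : PhaseSpace N → ℝ, ContDiff ℝ ((⊤ : ℕ∞) : WithTop ℕ∞) F → HasCompactSupport F →
              Tendsto (fun δ : ℝ => ((∫ x, F x ∂(μ N (T + δ / 2) (T - δ / 2))) - ∫ x, F x ∂(μ N T T)) / δ)
                (𝓝[≠] (0 : ℝ)) (𝓝 (∫ x, F x * h x ∂(μ N T T)))) ∧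
            (∀ i : Fin N, Tendsto (fun δ : ℝ =>
                ((∫ x, (pinnedChain ω₂ lam β γ).bondCurrent N i x ∂(μ N (T + δ / 2) (T - δ / 2))) -
                  ∫ x, (pinnedChain ω₂ lam β γ).bondCurrent N i x ∂(μ N T T)) / δ)
                (𝓝[≠] (0 : ℝ)) (𝓝 (∫ x, (pinnedChain ω₂ lam β γ).bondCurrent N i x * h x ∂(μ N T T))))) →
          ∃ η₀ : ℝ, 0 < η₀ ∧
            (∀ K' : ℝ, ∫ x, (h x - h (x.1, -x.2)) ^ 2 ∂(μ N T T) < K' →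
              ∃ η : ℝ, 0 < η ∧ η < η₀ ∧
                ∫ x, (h x - h (x.1, -x.2)) ^ 2 *
                  Real.cosh (η * (1 + (pinnedChain ω₂ lam β γ).hamiltonian N x)) ∂(μ N T T) < K') ∧
            ∀ η : ℝ, 0 < η → η < η₀ →
              ∀ s : ℝ → PhaseSpace N → ℝ, (∀ δ, Measurable (s δ)) → (∀ δ x, 0 < s δ x) →
                (∀ᶠ δ in 𝓝[≠] (0 : ℝ), μ N (T + δ / 2) (T - δ / 2) =
                  (volume : Measure (PhaseSpace N)).withDensity (fun x => ENNReal.ofReal (s δ x ^ 2))) →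
                (∀ᶠ δ in 𝓝[≠] (0 : ℝ), Integrable (fun x : PhaseSpace N => (s δ x - s δ (x.1, -x.2)) ^ 2 *
                    Real.cosh (η * (1 + (pinnedChain ω₂ lam β γ).hamiltonian N x))) (volume : Measure (PhaseSpace N))) ∧
                Tendsto (fun δ : ℝ => (δ ^ 2)⁻¹ * ∫ x, (s δ x - s δ (x.1, -x.2)) ^ 2 *
                    Real.cosh (η * (1 + (pinnedChain ω₂ lam β γ).hamiltonian N x)) ∂(volume : Measure (PhaseSpace N)))
                  (𝓝[≠] (0 : ℝ))
                  (𝓝 ((1 / 4 : ℝ) * ∫ x, (h x - h (x.1, -x.2)) ^ 2 *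
                    Real.cosh (η * (1 + (pinnedChain ω₂ lam β γ).hamiltonian N x)) ∂(μ N T T))))
    (hK : ∀ ω₂ lam β γ : ℝ, 0 < ω₂ → 0 < lam → 0 < β → 0 < γ → ∀ T : ℝ, 0 < T → ∃ C : ℝ,
      ∀ (N : ℕ) (u : PhaseSpace N → ℝ), 2 ≤ N →
        MemLp u 2 ((pinnedChain ω₂ lam β γ).gibbsMeasure N T) →
        (∀ᵐ x ∂((pinnedChain ω₂ lam β γ).gibbsMeasure N T), Tendsto (fun τ : ℝ => ∫ t in Set.Ioc (0 : ℝ) τ,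
            (∫ y, (∑ i : Fin N, (pinnedChain ω₂ lam β γ).bondCurrent N i y)
              ∂((pinnedChain ω₂ lam β γ).transitionKernel N T T t.toNNReal x))) atTop (𝓝 (u x))) →
        ∫ x, (u x - u (x.1, -x.2)) ^ 2 ∂((pinnedChain ω₂ lam β γ).gibbsMeasure N T) ≤ C * (N : ℝ) ^ 3) :
    ExtensiveSnapshotIrreversibility :=
  crux_of_klExpansion_of_cubic (snapshotKLUpperExpansion_of_hellinger h0 hA hB) hK

/-- **The composition** — concludes the crux `ExtensiveSnapshotIrreversibility` BY NAME from the four registered stubs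
(fixed-`N` atoms S_H1a/S_H1b/S_H2a/S_H2b — S_H0 LANDED p170482, S_H1/S_H2 DERIVED — and S4k `N`-uniform); the five `sorry`s are the only debt. -/
theorem ExtensiveSnapshotIrreversibility_of : ExtensiveSnapshotIrreversibility :=
  ExtensiveSnapshotIrreversibility_of_parts stub_klDiv_flip_le_logMeanHellinger stub_oddLogDensitySandwich
    stub_weightedOddDQM stub_kuboCorrectorOddCubicBound

end Summit.AtomisticToContinuum.FouriersLaw.Cruxes.ExtensiveSnapshotIrreversibility.HellingerLogMean

end
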